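import Literature.NumberTheory.LFunctions.ZetaLogDerivSeries
import Mathlib.Analysis.Complex.CauchyIntegral
import Mathlib.MeasureTheory.Integral.CircleIntegral
import HarnessLib

/-!
# The `u`-plane Cauchy formula for `ξ₁⁽ⁿ⁾(v²)` and the right/left half-arc split

RH ladder column JENSEN, rung J-P(P3) «log band», BAND crux `XiDerivBandRealAllRates` of route
«JensenLogBand» — line «band-kkl-arc-port» (idea card
`Summits/RiemannHypothesis/RiemannHypothesis/Ideas/…band-kkl-arc-port`), lead rh-jensen-prover g7.
RH-FREE plumbing. WHAT THIS IS NOT: an exact integral identity for derivatives of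
`ξ₁(z) = ξ(½ + √z)`; nothing here bears on zeros of `ζ` or the truth of RH.

**Why the `u`-plane.** With `z = u²`, `ξ₁(z) = ξ(½ + u)` (`xiSq_sq`), and `dz/(z − v²)^{n+1}`
pulls back to `2u du/((u − v)(u + v))^{n+1}`. Cauchy's formula for the `n`-th derivative of `ξ₁`
at `w = v²` can therefore be written over the CIRCLE `|u − v| = h` of the `s`-plane
(`s = ½ + u`), as long as `0 < h < 2‖v‖` (so that `−v` stays outside):

  `ξ₁⁽ⁿ⁾(v²) = (n!/2πi) ∮_{|u−v|=h} ξ₁(u²) · 2u · (u² − v²)^{−(n+1)} du`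
  (`LogBandArc.circleIntegral_sq_kernel`, proved for every entire `F` in place of `ξ₁` by
  induction on `n`: integration by parts `∮ F(u²) 2u (u²−v²)^{−(n+2)} = (n+1)⁻¹ ∮ F'(u²) 2u (u²−v²)^{−(n+1)}`
  and the base case `2u/(u²−v²) = 1/(u−v) + 1/(u+v)`).

Along an exact circle in the `s`-plane the Stirling expansion of the `Γ`-factor of `ξ` and the
`ζ`-bounds right of the `1`-line apply verbatim; this is why the BAND line integrates over
`u`-circles rather than over the `z`-circles of the original Cauchy formula (whose preimages in
the `s`-plane are ovals).

**The split.** Cutting the circle at `θ = ±π/2` gives the right half-arc transform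
`U_{n,h}(v) = (n!/2πi) ∫_{−π/2}^{π/2} …` (`LogBandArc.xiSqArcU`) and the left half-arc; by
`ξ₁(conj z) = conj ξ₁(z)` and `u ↦ −ū` (which maps the left half of the circle about `v` onto the
right half of the circle about `−v̄`) the left half equals `conj U_{n,h}(−v̄)`:

  `ξ₁⁽ⁿ⁾(v²) = U_{n,h}(v) + conj (U_{n,h}(−conj v))`   (`LogBandArc.iteratedDeriv_xiSq_sq_eq_arcU_add`).

So a zero `v² = (a + iT)²` of `ξ₁⁽ⁿ⁾` with `a ≠ 0` forces `‖U_{n,h}(−a + iT)‖ = ‖U_{n,h}(a + iT)‖`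
(`LogBandArc.norm_arcU_eq_of_zero`); the BAND line refutes this by DOMINANCE
`‖U(−a+iT)‖ < ‖U(a+iT)‖` for `0 < a ≤ ½` (the right half-arc about `a + iT` carries the saddle
window at abscissa `½ + a + h`, right of the one about `−a + iT`).
-/

noncomputable section

-- single-problem summit: `Summit.RiemannHypothesis.RiemannHypothesis.…` is the tree convention
set_option linter.dupNamespace false

open Complex Real MeasureTheory intervalIntegral Set Metric
open scoped ComplexConjugate

namespace Summit.RiemannHypothesis.RiemannHypothesis.Theorems.JensenPolynomials.LogBandArc

open Literature.NumberTheory.LFunctions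

/-! ## The `u`-plane kernel and the half-arc transform -/

/-- The `u`-plane Cauchy kernel of order `n` about `v`: `K_{n,v}(u) = 2u · ((u² − v²)^{n+1})⁻¹`
(the pull-back of `dz/(z − v²)^{n+1}` under `z = u²`, without the `du`). [folklore] -/
def sqKernel (n : ℕ) (v u : ℂ) : ℂ := 2 * u * ((u ^ 2 - v ^ 2) ^ (n + 1))⁻¹

/-- The integrand of the half-arc transform at angle `θ` on the circle `u = v + h e^{iθ}`:
`(d/dθ)(v + h e^{iθ}) · ξ₁(u²) · K_{n,v}(u)`. [folklore] -/
def arcIntegrandU (n : ℕ) (h : ℝ) (v : ℂ) (θ : ℝ) : ℂ :=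
  deriv (circleMap v h) θ * (xiSq (circleMap v h θ ^ 2) * sqKernel n v (circleMap v h θ))

/-- **The right half-arc transform** `U_{n,h}(v) = (n!/2πi) ∫_{−π/2}^{π/2} ξ₁(u²) K_{n,v}(u) du`,
`u = v + h e^{iθ}` — the part of the `u`-plane Cauchy integral for `ξ₁⁽ⁿ⁾(v²)` over the right half
`Re (u − v) ≥ 0` of the circle `|u − v| = h`. [folklore] -/
def xiSqArcU (n : ℕ) (h : ℝ) (v : ℂ) : ℂ :=
  (n.factorial : ℂ) / (2 * π * I) * ∫ θ in (-(π / 2))..(π / 2), arcIntegrandU n h v θ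

/-! ## The `u`-plane Cauchy formula (generic entire `F`) -/

/-- On the circle `|u − v| = h` with `0 < h < 2‖v‖` the kernel's denominator does not vanish:
`u² − v² ≠ 0`. [folklore] -/
theorem sq_sub_sq_ne_zero_of_mem_sphere {v u : ℂ} {h : ℝ} (hh : 0 < h) (hv : h < 2 * ‖v‖)
    (hu : u ∈ sphere v h) : u ^ 2 - v ^ 2 ≠ 0 := by
  rw [mem_sphere_iff_norm] at hu
  have h1 : u - v ≠ 0 := by
    intro h0; rw [h0, norm_zero] at hu; linarith
  have h2 : u + v ≠ 0 := by
    intro h0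
    have : u - v = -(2 * v) := by linear_combination h0
    rw [this, norm_neg, norm_mul, Complex.norm_ofNat] at hu
    linarith
  have : u ^ 2 - v ^ 2 = (u - v) * (u + v) := by ring
  rw [this]; exact mul_ne_zero h1 h2

/-- `u + v ≠ 0` on the closed disc `|u − v| ≤ h` when `h < 2‖v‖`. [folklore] -/
theorem add_ne_zero_of_mem_closedBall {v u : ℂ} {h : ℝ} (hv : h < 2 * ‖v‖)
    (hu : u ∈ closedBall v h) : u + v ≠ 0 := by
  rw [mem_closedBall_iff_norm] at hu
  intro h0
  have : u - v = -(2 * v) := by linear_combination h0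
  rw [this, norm_neg, norm_mul, Complex.norm_ofNat] at hu
  linarith

/-- A circle integral of an exact derivative vanishes: if `Φ` has derivative `Φ'(u)` at every point
`u` of the circle and `Φ'` is continuous there, then `∮ Φ' = 0`. [folklore] -/
theorem circleIntegral_eq_zero_of_hasDerivAt {Φ Φ' : ℂ → ℂ} {v : ℂ} {h : ℝ}
    (hd : ∀ θ : ℝ, HasDerivAt Φ (Φ' (circleMap v h θ)) (circleMap v h θ))
    (hc : Continuous fun θ : ℝ => Φ' (circleMap v h θ)) :
    (∮ u in C(v, h), Φ' u) = 0 := by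
  rw [circleIntegral]
  have hderiv : ∀ θ ∈ uIcc 0 (2 * π),
      HasDerivAt (Φ ∘ circleMap v h) (deriv (circleMap v h) θ • Φ' (circleMap v h θ)) θ := by
    intro θ _
    have := (hd θ).comp θ (hasDerivAt_circleMap v h θ)
    rw [deriv_circleMap, smul_eq_mul, mul_comm]
    exact this
  have hint : IntervalIntegrable (fun θ => deriv (circleMap v h) θ • Φ' (circleMap v h θ))
      volume 0 (2 * π) := by
    apply Continuous.intervalIntegrable
    simp only [deriv_circleMap, smul_eq_mul]
    exact ((continuous_circleMap 0 h).mul continuous_const).mul hc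
  rw [integral_eq_sub_of_hasDerivAt hderiv hint]
  simp only [Function.comp_apply]
  have : circleMap v h (2 * π) = circleMap v h 0 := by
    have := periodic_circleMap v h 0
    rw [zero_add] at this; exact this
  rw [this, sub_self]

/-- **Integration by parts on the `u`-circle**: for an entire `F` and `0 < h < 2‖v‖`,
`∮ F(u²) 2u (u²−v²)^{−(n+2)} du = (n+1)⁻¹ ∮ F'(u²) 2u (u²−v²)^{−(n+1)} du`
(the difference is the integral of `(d/du)[F(u²)(u²−v²)^{−(n+1)}]/(−(n+1))`). [folklore] -/
theorem circleIntegral_sq_kernel_succ {F : ℂ → ℂ} (hF : Differentiable ℂ F) {v : ℂ} {h : ℝ}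
    (hh : 0 < h) (hv : h < 2 * ‖v‖) (n : ℕ) :
    (∮ u in C(v, h), F (u ^ 2) * sqKernel (n + 1) v u) =
      ((n : ℂ) + 1)⁻¹ * ∮ u in C(v, h), deriv F (u ^ 2) * sqKernel n v u := by
  -- `Φ(u) = F(u²) ((u²−v²)^{n+1})⁻¹` and its derivative on the circle
  set Φ : ℂ → ℂ := fun u => F (u ^ 2) * ((u ^ 2 - v ^ 2) ^ (n + 1))⁻¹ with hΦ
  set Φ' : ℂ → ℂ := fun u => deriv F (u ^ 2) * sqKernel n v u -
      ((n : ℂ) + 1) * (F (u ^ 2) * sqKernel (n + 1) v u) with hΦ'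
  have hne : ∀ θ : ℝ, circleMap v h θ ^ 2 - v ^ 2 ≠ 0 := fun θ =>
    sq_sub_sq_ne_zero_of_mem_sphere hh hv (circleMap_mem_sphere v hh.le θ)
  have hd : ∀ θ : ℝ, HasDerivAt Φ (Φ' (circleMap v h θ)) (circleMap v h θ) := by
    intro θ
    set u := circleMap v h θ with hu
    have hq : u ^ 2 - v ^ 2 ≠ 0 := hne θ
    -- derivative of `u ↦ F(u²)`
    have h1 : HasDerivAt (fun u : ℂ => F (u ^ 2)) (deriv F (u ^ 2) * (2 * u)) u := by
      have hsq : HasDerivAt (fun u : ℂ => u ^ 2) (2 * u) u := by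
        simpa using hasDerivAt_pow 2 u
      exact (hF (u ^ 2)).hasDerivAt.comp u hsq
    -- derivative of `u ↦ ((u²−v²)^{n+1})⁻¹`
    have hsq' : HasDerivAt (fun u : ℂ => u ^ 2 - v ^ 2) (2 * u) u := by
      simpa using (hasDerivAt_pow 2 u).sub_const (v ^ 2)
    have hp : HasDerivAt (fun u : ℂ => (u ^ 2 - v ^ 2) ^ (n + 1))
        (((n + 1 : ℕ) : ℂ) * (u ^ 2 - v ^ 2) ^ (n + 1 - 1) * (2 * u)) u := hsq'.fun_pow (n + 1)
    have h2 : HasDerivAt (fun u : ℂ => ((u ^ 2 - v ^ 2) ^ (n + 1))⁻¹)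
        (-(((n + 1 : ℕ) : ℂ) * (u ^ 2 - v ^ 2) ^ (n + 1 - 1) * (2 * u)) /
          ((u ^ 2 - v ^ 2) ^ (n + 1)) ^ 2) u := hp.fun_inv (pow_ne_zero _ hq)
    have h12 := h1.mul h2
    refine h12.congr_deriv ?_
    simp only [hΦ', sqKernel, Nat.add_sub_cancel, Nat.cast_add, Nat.cast_one]
    field_simp
    ring
  have hcm : Continuous (circleMap v h) := continuous_circleMap v h
  have hF' : Continuous (deriv F) := hF.deriv.continuous
  have hinvc : ∀ m : ℕ, Continuous fun θ : ℝ => ((circleMap v h θ ^ 2 - v ^ 2) ^ (m + 1))⁻¹ :=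
    fun m => Continuous.inv₀ (by fun_prop) fun θ => pow_ne_zero _ (hne θ)
  have hkc : ∀ m : ℕ, Continuous fun θ : ℝ => sqKernel m v (circleMap v h θ) := by
    intro m
    simp only [sqKernel]
    exact (continuous_const.mul hcm).mul (hinvc m)
  have hc : Continuous fun θ : ℝ => Φ' (circleMap v h θ) := by
    simp only [hΦ']
    exact ((hF'.comp (hcm.pow 2)).mul (hkc n)).sub
      (continuous_const.mul ((hF.continuous.comp (hcm.pow 2)).mul (hkc (n + 1))))
  have h0 := circleIntegral_eq_zero_of_hasDerivAt hd hc
  -- split `∮ Φ' = ∮ A − (n+1) ∮ B = 0`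
  have hkco : ∀ m : ℕ, ContinuousOn (fun u : ℂ => sqKernel m v u) (sphere v h) := by
    intro m
    simp only [sqKernel]
    refine ContinuousOn.mul (Continuous.continuousOn (by fun_prop)) ?_
    refine ContinuousOn.inv₀ (Continuous.continuousOn (by fun_prop)) fun u hu => ?_
    exact pow_ne_zero _ (sq_sub_sq_ne_zero_of_mem_sphere hh hv hu)
  have hcontA : ContinuousOn (fun u : ℂ => deriv F (u ^ 2) * sqKernel n v u) (sphere v h) :=
    ((hF'.comp (continuous_pow 2)).continuousOn).mul (hkco n)
  have hcontB : ContinuousOn (fun u : ℂ => F (u ^ 2) * sqKernel (n + 1) v u) (sphere v h) :=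
    ((hF.continuous.comp (continuous_pow 2)).continuousOn).mul (hkco (n + 1))
  have hcontB' : ContinuousOn (fun u : ℂ => ((n : ℂ) + 1) * (F (u ^ 2) * sqKernel (n + 1) v u))
      (sphere v h) := continuousOn_const.mul hcontB
  have hA := hcontA.circleIntegrable hh.le
  have hB' := hcontB'.circleIntegrable hh.le
  have hsplit : (∮ u in C(v, h), Φ' u) = (∮ u in C(v, h), deriv F (u ^ 2) * sqKernel n v u) -
      ((n : ℂ) + 1) * ∮ u in C(v, h), F (u ^ 2) * sqKernel (n + 1) v u := by
    simp only [hΦ']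
    rw [circleIntegral.integral_sub hA hB', circleIntegral.integral_const_mul]
  rw [hsplit] at h0
  have hn : ((n : ℂ) + 1) ≠ 0 := by exact_mod_cast Nat.succ_ne_zero n
  have := sub_eq_zero.1 h0
  rw [this]
  field_simp

/-- **Base case**: `∮ F(u²) · 2u/(u² − v²) du = 2πi F(v²)` (`2u/(u²−v²) = 1/(u−v) + 1/(u+v)`;
Cauchy's integral formula at `v` and Cauchy's theorem for `F(u²)/(u+v)`). [folklore] -/
theorem circleIntegral_sq_kernel_zero {F : ℂ → ℂ} (hF : Differentiable ℂ F) {v : ℂ} {h : ℝ}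
    (hh : 0 < h) (hv : h < 2 * ‖v‖) :
    (∮ u in C(v, h), F (u ^ 2) * sqKernel 0 v u) = 2 * π * I * F (v ^ 2) := by
  have hne : ∀ u ∈ sphere v h, u ^ 2 - v ^ 2 ≠ 0 := fun u hu =>
    sq_sub_sq_ne_zero_of_mem_sphere hh hv hu
  -- rewrite the integrand on the circle as `(u−v)⁻¹ F(u²) + F(u²)/(u+v)`
  have heq : (∮ u in C(v, h), F (u ^ 2) * sqKernel 0 v u) =
      ∮ u in C(v, h), ((u - v)⁻¹ • F (u ^ 2) + F (u ^ 2) * (u + v)⁻¹) := by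
    refine circleIntegral.integral_congr hh.le fun u hu => ?_
    have hq := hne u hu
    have h1 : u - v ≠ 0 := fun h0 => hq (by rw [show u = v by linear_combination h0]; ring)
    have h2 : u + v ≠ 0 := add_ne_zero_of_mem_closedBall hv (sphere_subset_closedBall hu)
    simp only [sqKernel, zero_add, pow_one, smul_eq_mul]
    field_simp
    ring
  rw [heq]
  have hinv1 : ContinuousOn (fun u : ℂ => (u - v)⁻¹) (sphere v h) := by
    refine ContinuousOn.inv₀ (Continuous.continuousOn (by fun_prop)) fun u hu h0 => ?_
    rw [mem_sphere_iff_norm, sub_eq_zero.1 h0, sub_self, norm_zero] at hu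
    exact hh.ne' hu.symm
  have hcont1 : ContinuousOn (fun u : ℂ => (u - v)⁻¹ • F (u ^ 2)) (sphere v h) :=
    hinv1.smul (hF.continuous.comp (continuous_pow 2)).continuousOn
  have hcont2 : ContinuousOn (fun u : ℂ => F (u ^ 2) * (u + v)⁻¹) (closedBall v h) := by
    refine ContinuousOn.mul (hF.continuous.comp (continuous_pow 2)).continuousOn ?_
    exact ContinuousOn.inv₀ (Continuous.continuousOn (by fun_prop))
      fun u hu => add_ne_zero_of_mem_closedBall hv hu
  rw [circleIntegral.integral_add (hcont1.circleIntegrable hh.le)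
    ((hcont2.mono sphere_subset_closedBall).circleIntegrable hh.le)]
  -- Cauchy's integral formula for `u ↦ F(u²)` at the centre
  have hcauchy : (∮ u in C(v, h), (u - v)⁻¹ • F (u ^ 2)) = (2 * π * I : ℂ) • F (v ^ 2) := by
    have hdc : DiffContOnCl ℂ (fun u : ℂ => F (u ^ 2)) (ball v h) :=
      (hF.comp (differentiable_pow 2)).diffContOnCl
    exact hdc.circleIntegral_sub_inv_smul (mem_ball_self hh)
  -- Cauchy's theorem for `F(u²)/(u+v)` (holomorphic on the closed disc)
  have hzero : (∮ u in C(v, h), F (u ^ 2) * (u + v)⁻¹) = 0 := by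
    refine Complex.circleIntegral_eq_zero_of_differentiable_on_off_countable hh.le
      countable_empty hcont2 fun u hu => ?_
    have h2 : u + v ≠ 0 := add_ne_zero_of_mem_closedBall hv (ball_subset_closedBall hu.1)
    exact ((hF (u ^ 2)).comp u (differentiable_pow 2 u)).mul
      ((differentiableAt_id.add_const v).inv h2)
  rw [hcauchy, hzero, add_zero, smul_eq_mul]

/-- **The `u`-plane Cauchy formula for derivatives** (generic entire `F`): for `0 < h < 2‖v‖`,
`∮_{|u−v|=h} F(u²) · 2u (u²−v²)^{−(n+1)} du = (2πi/n!) F⁽ⁿ⁾(v²)`. [folklore] -/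
theorem circleIntegral_sq_kernel {F : ℂ → ℂ} (hF : Differentiable ℂ F) {v : ℂ} {h : ℝ}
    (hh : 0 < h) (hv : h < 2 * ‖v‖) (n : ℕ) :
    (∮ u in C(v, h), F (u ^ 2) * sqKernel n v u) =
      2 * π * I / (n.factorial : ℂ) * iteratedDeriv n F (v ^ 2) := by
  induction n generalizing F with
  | zero => simp [circleIntegral_sq_kernel_zero hF hh hv]
  | succ n ih =>
    rw [circleIntegral_sq_kernel_succ hF hh hv n, ih hF.deriv, ← iteratedDeriv_succ',
      Nat.factorial_succ]
    have hn : ((n : ℂ) + 1) ≠ 0 := by exact_mod_cast Nat.succ_ne_zero n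
    have hnf : (n.factorial : ℂ) ≠ 0 := by exact_mod_cast Nat.factorial_ne_zero n
    push_cast
    field_simp

/-! ## The split for `ξ₁` -/

/-- The arc integrand is continuous in the angle (for `0 < h < 2‖v‖`). [folklore] -/
theorem continuous_arcIntegrandU (n : ℕ) {h : ℝ} {v : ℂ} (hh : 0 < h) (hv : h < 2 * ‖v‖) :
    Continuous (arcIntegrandU n h v) := by
  unfold arcIntegrandU sqKernel
  simp only [deriv_circleMap]
  have hcm : Continuous (circleMap v h) := continuous_circleMap v h
  have hinv : Continuous fun θ : ℝ => ((circleMap v h θ ^ 2 - v ^ 2) ^ (n + 1))⁻¹ :=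
    Continuous.inv₀ (by fun_prop) fun θ =>
      pow_ne_zero _ (sq_sub_sq_ne_zero_of_mem_sphere hh hv (circleMap_mem_sphere v hh.le θ))
  exact ((continuous_circleMap 0 h).mul continuous_const).mul
    ((differentiable_xiSq.continuous.comp (hcm.pow 2)).mul ((continuous_const.mul hcm).mul hinv))

/-- The arc integrand is `2π`-periodic in the angle. [folklore] -/
theorem periodic_arcIntegrandU (n : ℕ) (h : ℝ) (v : ℂ) :
    Function.Periodic (arcIntegrandU n h v) (2 * π) := by
  intro θ
  simp only [arcIntegrandU, deriv_circleMap, periodic_circleMap v h θ, periodic_circleMap 0 h θ]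

/-- The full circle integral is the integral of the arc integrand over `[−π/2, 3π/2]`.
[folklore] -/
theorem circleIntegral_eq_integral_arcIntegrandU (n : ℕ) (h : ℝ) (v : ℂ) :
    (∮ u in C(v, h), xiSq (u ^ 2) * sqKernel n v u) =
      ∫ θ in (-(π / 2))..(3 * π / 2), arcIntegrandU n h v θ := by
  rw [circleIntegral]
  have hper := periodic_arcIntegrandU n h v
  have h1 : (∫ θ in (0 : ℝ)..2 * π, deriv (circleMap v h) θ • (xiSq (circleMap v h θ ^ 2) *
      sqKernel n v (circleMap v h θ))) = ∫ θ in (0 : ℝ)..0 + 2 * π, arcIntegrandU n h v θ := by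
    rw [zero_add]; rfl
  rw [h1, hper.intervalIntegral_add_eq 0 (-(π / 2))]
  congr 1; ring

/-- **Reflection of the arc integrand**: `I_v(π − θ) = −conj (I_{−v̄}(θ))` — the point
`v + h e^{i(π−θ)}` is `−conj(−v̄ + h e^{iθ})`, `ξ₁(conj z) = conj ξ₁(z)`, and the kernel has real
structure. [folklore] -/
theorem arcIntegrandU_pi_sub (n : ℕ) (h : ℝ) (v : ℂ) (θ : ℝ) :
    arcIntegrandU n h v (π - θ) = -conj (arcIntegrandU n h (-conj v) θ) := by
  have hexp : cexp (((π - θ : ℝ) : ℂ) * I) = -cexp (-(θ : ℂ) * I) := by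
    rw [show ((π - θ : ℝ) : ℂ) * I = (π : ℂ) * I + -(θ : ℂ) * I by push_cast; ring,
      Complex.exp_add, Complex.exp_pi_mul_I]
    ring
  have hconj_exp : conj (cexp ((θ : ℂ) * I)) = cexp (-(θ : ℂ) * I) := by
    rw [← Complex.exp_conj, map_mul, Complex.conj_ofReal, Complex.conj_I]
    ring_nf
  have hpt : circleMap v h (π - θ) = -conj (circleMap (-conj v) h θ) := by
    simp only [circleMap]
    rw [hexp, map_add, map_neg, Complex.conj_conj, map_mul, Complex.conj_ofReal, hconj_exp]
    ring
  have hder : deriv (circleMap v h) (π - θ) = conj (deriv (circleMap (-conj v) h) θ) := by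
    simp only [deriv_circleMap, circleMap, zero_add]
    rw [hexp, map_mul, map_mul, Complex.conj_ofReal, hconj_exp, Complex.conj_I]
    ring
  have hker : ∀ u : ℂ, sqKernel n v (-conj u) = -conj (sqKernel n (-conj v) u) := by
    intro u
    simp only [sqKernel, map_mul, map_inv₀, map_pow, map_sub, neg_sq, Complex.conj_conj, map_ofNat]
    ring
  rw [arcIntegrandU, arcIntegrandU, hder, hpt, hker, neg_sq, ← map_pow, xiSq_conj]
  simp only [map_mul]
  ring

/-- The left half-arc is the conjugate-reflected right half-arc about `−v̄`:
`∫_{π/2}^{3π/2} I_v = −conj ∫_{−π/2}^{π/2} I_{−v̄}`. [folklore] -/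
theorem integral_left_arc_eq (n : ℕ) (h : ℝ) (v : ℂ) :
    (∫ θ in (π / 2)..(3 * π / 2), arcIntegrandU n h v θ) =
      -conj (∫ θ in (-(π / 2))..(π / 2), arcIntegrandU n h (-conj v) θ) := by
  have hsub : (∫ θ in (-(π / 2))..(π / 2), arcIntegrandU n h v (π - θ)) =
      ∫ θ in (π - π / 2)..(π - -(π / 2)), arcIntegrandU n h v θ :=
    intervalIntegral.integral_comp_sub_left (arcIntegrandU n h v) π
  have hlim1 : π - π / 2 = π / 2 := by ring
  have hlim2 : π - -(π / 2) = 3 * π / 2 := by ring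
  rw [hlim1, hlim2] at hsub
  rw [← hsub]
  simp only [arcIntegrandU_pi_sub]
  rw [intervalIntegral.integral_neg, intervalIntegral.intervalIntegral_conj]

/-- **THE SPLIT (RH-free):** for `v ≠ 0` and `0 < h < 2‖v‖`,
`ξ₁⁽ⁿ⁾(v²) = U_{n,h}(v) + conj (U_{n,h}(−v̄))` — the `n`-th derivative of `ξ₁ = ξ(½ + √·)` at `v²`
is the right half-arc transform about `v` plus the conjugate of the right half-arc transform about
the reflected centre `−v̄` (left half of the `u`-circle about `v`, reflected in the critical
line). [folklore] -/
theorem iteratedDeriv_xiSq_sq_eq_arcU_add (n : ℕ) {h : ℝ} {v : ℂ} (hh : 0 < h)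
    (hv : h < 2 * ‖v‖) :
    iteratedDeriv n xiSq (v ^ 2) = xiSqArcU n h v + conj (xiSqArcU n h (-conj v)) := by
  have hI : (2 * π * I : ℂ) ≠ 0 := by simp [Real.pi_ne_zero, I_ne_zero]
  have hnf : (n.factorial : ℂ) ≠ 0 := by exact_mod_cast Nat.factorial_ne_zero n
  -- the full circle
  have hfull := circleIntegral_sq_kernel differentiable_xiSq hh hv n
  rw [circleIntegral_eq_integral_arcIntegrandU n h v] at hfull
  -- cut at `π/2`
  have hcont := continuous_arcIntegrandU n hh hv
  have hadd := intervalIntegral.integral_add_adjacent_intervals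
    (hcont.intervalIntegrable (μ := volume) (-(π / 2)) (π / 2))
    (hcont.intervalIntegrable (μ := volume) (π / 2) (3 * π / 2))
  rw [← hadd, integral_left_arc_eq] at hfull
  -- solve for the derivative
  have hderiv : iteratedDeriv n xiSq (v ^ 2) = (n.factorial : ℂ) / (2 * π * I) *
      ((∫ θ in (-(π / 2))..(π / 2), arcIntegrandU n h v θ) +
        -conj (∫ θ in (-(π / 2))..(π / 2), arcIntegrandU n h (-conj v) θ)) := by
    rw [hfull]; field_simp
  rw [hderiv, xiSqArcU, xiSqArcU, map_mul, map_div₀, map_mul, map_mul, Complex.conj_I,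
    map_ofNat, Complex.conj_ofReal, map_natCast]
  field_simp

/-- **Consequence used by the BAND line:** if `ξ₁⁽ⁿ⁾(v²) = 0` (`v ≠ 0`, `0 < h < 2‖v‖`), the two
right half-arc transforms about `v` and `−v̄` have the same modulus. [folklore] -/
theorem norm_arcU_eq_of_zero (n : ℕ) {h : ℝ} {v : ℂ} (hh : 0 < h) (hv : h < 2 * ‖v‖)
    (hz : iteratedDeriv n xiSq (v ^ 2) = 0) :
    ‖xiSqArcU n h (-conj v)‖ = ‖xiSqArcU n h v‖ := by
  rw [iteratedDeriv_xiSq_sq_eq_arcU_add n hh hv] at hz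
  have h1 : xiSqArcU n h v = -conj (xiSqArcU n h (-conj v)) := eq_neg_of_add_eq_zero_left hz
  rw [h1, norm_neg, Complex.norm_conj]

/-- The dominance principle: strict dominance `‖U(−v̄)‖ < ‖U(v)‖` excludes a zero of `ξ₁⁽ⁿ⁾` at
`v²`. [folklore] -/
theorem iteratedDeriv_xiSq_sq_ne_zero_of_dominance (n : ℕ) {h : ℝ} {v : ℂ} (hh : 0 < h)
    (hv : h < 2 * ‖v‖) (hdom : ‖xiSqArcU n h (-conj v)‖ < ‖xiSqArcU n h v‖) :
    iteratedDeriv n xiSq (v ^ 2) ≠ 0 := fun hz =>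
  (norm_arcU_eq_of_zero n hh hv hz).not_lt hdom

end Summit.RiemannHypothesis.RiemannHypothesis.Theorems.JensenPolynomials.LogBandArc

end
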